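import Summits.Ventures.HodgeRepro.BallCore
import Summits.Ventures.HodgeRepro.BallTopology

/-!
# Holomorphic fields on the 2-ball: the Hecke-translate wedge is generically non-zero (seat p5)

Blind re-derivation cell `pub-hodge-repro`, seat `p5` (second seat on statement (c)).  Built on the sealer's
`BallModel.lean`, on `BallChainRule.lean` / `BallCore.lean` and on typer-2's `BallTopology.lean`.  Nothing
here says anything about the status of the Hodge conjecture for CM abelian varieties, which is NOT proved.

Statement (c) produces ONE point `z` with `(γ^*F)(z) ∧ G(z) ≠ 0`.  In the geometric use (lifts of holomorphic
one-forms on a ball quotient) the fields are holomorphic, and then the wedge — a holomorphic function on the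
ball — is non-zero on an open DENSE subset as soon as it is non-zero somewhere (identity principle on the
connected ball).  This file records that step for fields that are restrictions of `ℂ`-analytic maps
`ℂ² → ℂ²` on the open ball `ballSet = {z : Fin 2 → ℂ | nsq z < 1}`:

* `ballSet` is open and star-shaped about `0`, hence preconnected (`isPreconnected_ballSet`);
* the action `actE`, the Jacobian `JacE`, the translate `pullE` and the wedge `wedgeE` are `ℂ`-analytic on
  `ballSet` (rational in `z` with the non-vanishing denominator `(γ·(z,1))₂`; `F ∘ actE` by composition);
* `dense_wedge_ne_of_analyticOnNhd` — for analytic `F, G` and any `γ`, if the wedge is non-zero at one point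
  of the ball it is non-zero on a dense subset (`AnalyticOnNhd.eqOn_zero_of_preconnected_of_eventuallyEq_zero`);
* `exists_mem_isOpen_dense_wedge_ne` — the "generic" form of statement (c): for a dense subgroup `Δ` and
  analytic, not identically zero `F, G`, some `γ ∈ Δ` has `{z | (γ^*F)(z) ∧ G(z) ≠ 0}` open and dense in `𝔹²`.
-/

set_option autoImplicit false

noncomputable section

namespace Summit.Ventures.HodgeRepro

namespace BallHolo

open Matrix hiding J
open BallModel BallCore

/-! ### The open ball as a subset of `ℂ²`: open, star-shaped, preconnected -/

/-- The open unit ball `{z ∈ ℂ² : |z₀|² + |z₁|² < 1}` as a subset of `ℂ²` (the carrier of `Ball`). -/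
def ballSet : Set (Fin 2 → ℂ) := {z | nsq z < 1}

/-- Membership in `ballSet`. -/
theorem mem_ballSet {z : Fin 2 → ℂ} : z ∈ ballSet ↔ nsq z < 1 := Iff.rfl

/-- Points of `Ball` lie in `ballSet`. -/
theorem val_mem_ballSet (z : Ball) : z.1 ∈ ballSet := z.2

/-- `nsq` is continuous. -/
theorem continuous_nsq : Continuous nsq := by
  unfold nsq
  fun_prop

/-- `ballSet` is open. -/
theorem isOpen_ballSet : IsOpen ballSet := isOpen_lt continuous_nsq continuous_const

/-- `nsq (t • z) = t² nsq z` for real `t`. -/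
theorem nsq_smul (t : ℝ) (z : Fin 2 → ℂ) : nsq (t • z) = t ^ 2 * nsq z := by
  simp only [nsq, Pi.smul_apply, norm_smul, Real.norm_eq_abs, mul_pow, sq_abs]
  ring

/-- `ballSet` is star-shaped about the origin. -/
theorem starConvex_ballSet : StarConvex ℝ 0 ballSet := by
  intro z hz a b ha hb hab
  rw [smul_zero, zero_add, mem_ballSet, nsq_smul]
  have hz' : nsq z < 1 := hz
  have hn : 0 ≤ nsq z := by unfold nsq; positivity
  have hb1 : b ≤ 1 := by linarith
  have hb2 : b ^ 2 ≤ 1 := by nlinarith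
  nlinarith

/-- The origin lies in `ballSet`. -/
theorem zero_mem_ballSet : (0 : Fin 2 → ℂ) ∈ ballSet := by
  rw [mem_ballSet]; simp [nsq]

/-- `ballSet` is preconnected (it is path-connected through the origin). -/
theorem isPreconnected_ballSet : IsPreconnected ballSet :=
  (starConvex_ballSet.isPathConnected zero_mem_ballSet).isConnected.isPreconnected

/-! ### The action, the Jacobian and the translate as functions on `ℂ²` -/

/-- The lift `z ↦ (z₀, z₁, 1)` on `ℂ²`. -/
def liftE (z : Fin 2 → ℂ) : Fin 3 → ℂ := ![z 0, z 1, 1]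

/-- `γ · (z, 1)` on `ℂ²`. -/
def W3E (γ : U21) (z : Fin 2 → ℂ) : Fin 3 → ℂ := mat γ *ᵥ liftE z

/-- The fractional-linear action on `ℂ²` (where the denominator does not vanish). -/
def actE (γ : U21) (z : Fin 2 → ℂ) : Fin 2 → ℂ :=
  ![W3E γ z 0 / W3E γ z 2, W3E γ z 1 / W3E γ z 2]

/-- The Jacobian on `ℂ²`. -/
def JacE (γ : U21) (z : Fin 2 → ℂ) : Matrix (Fin 2) (Fin 2) ℂ :=
  Matrix.of fun i j => (mat γ (Fin.castSucc i) (Fin.castSucc j) * W3E γ z 2 -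
    W3E γ z (Fin.castSucc i) * mat γ 2 (Fin.castSucc j)) / W3E γ z 2 ^ 2

/-- On the ball, `W3` is `W3E`. -/
theorem W3_eq_W3E (γ : U21) (z : Ball) : W3 γ z = W3E γ z.1 := rfl

/-- On the ball, the coordinates of `act γ z` are `actE γ z.1`. -/
theorem act_val_eq_actE (γ : U21) (z : Ball) : (act γ z).1 = actE γ z.1 := rfl

/-- On the ball, `Jac` is `JacE`. -/
theorem Jac_eq_JacE (γ : U21) (z : Ball) : Jac γ z = JacE γ z.1 := rfl

/-- The denominator `(γ·(z,1))₂` does not vanish on the ball. -/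
theorem W3E_two_ne_zero (γ : U21) {z : Fin 2 → ℂ} (hz : z ∈ ballSet) : W3E γ z 2 ≠ 0 :=
  W3_2_ne_zero γ ⟨z, hz⟩

/-- `actE γ z` lies in the ball for `z` in the ball. -/
theorem actE_mem_ballSet (γ : U21) {z : Fin 2 → ℂ} (hz : z ∈ ballSet) : actE γ z ∈ ballSet :=
  (act γ ⟨z, hz⟩).2

/-- The entries of `γ·(z,1)` are affine in `z`. -/
theorem W3E_apply (γ : U21) (z : Fin 2 → ℂ) (j : Fin 3) :
    W3E γ z j = mat γ j 0 * z 0 + mat γ j 1 * z 1 + mat γ j 2 := by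
  simp [W3E, liftE, Matrix.mulVec, dotProduct, Fin.sum_univ_three]

/-! ### Analyticity -/

/-- The coordinate functions of `ℂ²` are analytic. -/
@[fun_prop]
theorem analyticAt_coord (i : Fin 2) (z : Fin 2 → ℂ) : AnalyticAt ℂ (fun z : Fin 2 → ℂ => z i) z :=
  (ContinuousLinearMap.proj (R := ℂ) (φ := fun _ : Fin 2 => ℂ) i).analyticAt z

/-- The entries of `γ·(z,1)` are analytic (entire). -/
theorem analyticAt_W3E (γ : U21) (j : Fin 3) (z : Fin 2 → ℂ) :
    AnalyticAt ℂ (fun z => W3E γ z j) z := by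
  have h : (fun z : Fin 2 → ℂ => W3E γ z j) =
      fun z => mat γ j 0 * z 0 + mat γ j 1 * z 1 + mat γ j 2 := funext fun z => W3E_apply γ z j
  rw [h]
  fun_prop

/-- The coordinates of the action are analytic on the ball. -/
theorem analyticAt_actE (γ : U21) (i : Fin 2) {z : Fin 2 → ℂ} (hz : z ∈ ballSet) :
    AnalyticAt ℂ (fun z => actE γ z i) z := by
  have hne : W3E γ z 2 ≠ 0 := W3E_two_ne_zero γ hz
  fin_cases i
  · show AnalyticAt ℂ (fun z => W3E γ z 0 / W3E γ z 2) z
    exact (analyticAt_W3E γ 0 z).fun_div (analyticAt_W3E γ 2 z) hne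
  · show AnalyticAt ℂ (fun z => W3E γ z 1 / W3E γ z 2) z
    exact (analyticAt_W3E γ 1 z).fun_div (analyticAt_W3E γ 2 z) hne

/-- The action `z ↦ actE γ z` is analytic on the ball (as a map into `ℂ²`). -/
theorem analyticAt_actE_fun (γ : U21) {z : Fin 2 → ℂ} (hz : z ∈ ballSet) :
    AnalyticAt ℂ (actE γ) z :=
  AnalyticAt.pi fun i => analyticAt_actE γ i hz

/-- The entries of the Jacobian are analytic on the ball. -/
theorem analyticAt_JacE (γ : U21) (i j : Fin 2) {z : Fin 2 → ℂ} (hz : z ∈ ballSet) :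
    AnalyticAt ℂ (fun z => JacE γ z i j) z := by
  have hne : W3E γ z 2 ^ 2 ≠ 0 := pow_ne_zero 2 (W3E_two_ne_zero γ hz)
  show AnalyticAt ℂ (fun z => (mat γ (Fin.castSucc i) (Fin.castSucc j) * W3E γ z 2 -
    W3E γ z (Fin.castSucc i) * mat γ 2 (Fin.castSucc j)) / W3E γ z 2 ^ 2) z
  have h1 := analyticAt_W3E γ 2 z
  have h2 := analyticAt_W3E γ (Fin.castSucc i) z
  exact ((analyticAt_const.fun_mul h1).fun_sub (h2.fun_mul analyticAt_const)).fun_div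
    (h1.fun_pow 2) hne

/-- The translate `(γ^*F)(z) = J_γ(z)ᵀ F(γ z)` on `ℂ²`, for a field `F : ℂ² → ℂ²`. -/
def pullE (γ : U21) (F : (Fin 2 → ℂ) → (Fin 2 → ℂ)) (z : Fin 2 → ℂ) : Fin 2 → ℂ :=
  (JacE γ z)ᵀ *ᵥ F (actE γ z)

/-- The entries of the translate. -/
theorem pullE_apply (γ : U21) (F : (Fin 2 → ℂ) → (Fin 2 → ℂ)) (z : Fin 2 → ℂ) (i : Fin 2) :
    pullE γ F z i = JacE γ z 0 i * F (actE γ z) 0 + JacE γ z 1 i * F (actE γ z) 1 := by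
  simp [pullE, Matrix.mulVec, dotProduct, Fin.sum_univ_two]

/-- For an analytic field, `z ↦ F (actE γ z) k` is analytic on the ball. -/
theorem analyticAt_comp_actE {F : (Fin 2 → ℂ) → (Fin 2 → ℂ)} (hF : AnalyticOnNhd ℂ F ballSet)
    (γ : U21) (k : Fin 2) {z : Fin 2 → ℂ} (hz : z ∈ ballSet) :
    AnalyticAt ℂ (fun z => F (actE γ z) k) z :=
  (analyticAt_coord k _).comp ((hF _ (actE_mem_ballSet γ hz)).comp (analyticAt_actE_fun γ hz))

/-- The entries of the translate of an analytic field are analytic on the ball. -/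
theorem analyticAt_pullE {F : (Fin 2 → ℂ) → (Fin 2 → ℂ)} (hF : AnalyticOnNhd ℂ F ballSet)
    (γ : U21) (i : Fin 2) {z : Fin 2 → ℂ} (hz : z ∈ ballSet) :
    AnalyticAt ℂ (fun z => pullE γ F z i) z := by
  have h : (fun z => pullE γ F z i) =
      fun z => JacE γ z 0 i * F (actE γ z) 0 + JacE γ z 1 i * F (actE γ z) 1 :=
    funext fun z => pullE_apply γ F z i
  rw [h]
  exact ((analyticAt_JacE γ 0 i hz).fun_mul (analyticAt_comp_actE hF γ 0 hz)).fun_add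
    ((analyticAt_JacE γ 1 i hz).fun_mul (analyticAt_comp_actE hF γ 1 hz))

/-- The wedge `(γ^*F)(z) ∧ G(z)` on `ℂ²`. -/
def wedgeE (γ : U21) (F G : (Fin 2 → ℂ) → (Fin 2 → ℂ)) (z : Fin 2 → ℂ) : ℂ :=
  wedge (pullE γ F z) (G z)

/-- On the ball, the wedge of statement (c) is `wedgeE`. -/
theorem wedge_eq_wedgeE (γ : U21) (F G : (Fin 2 → ℂ) → (Fin 2 → ℂ)) (z : Ball) :
    wedge ((Jac γ z)ᵀ *ᵥ F (act γ z).1) (G z.1) = wedgeE γ F G z.1 := rfl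

/-- The wedge of two analytic fields (one translated) is analytic on the ball. -/
theorem analyticOnNhd_wedgeE {F G : (Fin 2 → ℂ) → (Fin 2 → ℂ)} (hF : AnalyticOnNhd ℂ F ballSet)
    (hG : AnalyticOnNhd ℂ G ballSet) (γ : U21) : AnalyticOnNhd ℂ (wedgeE γ F G) ballSet := by
  intro z hz
  show AnalyticAt ℂ (fun z => pullE γ F z 0 * G z 1 - pullE γ F z 1 * G z 0) z
  have hG0 : AnalyticAt ℂ (fun z => G z 0) z := (analyticAt_coord 0 _).comp (hG z hz)
  have hG1 : AnalyticAt ℂ (fun z => G z 1) z := (analyticAt_coord 1 _).comp (hG z hz)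
  exact ((analyticAt_pullE hF γ 0 hz).fun_mul hG1).fun_sub ((analyticAt_pullE hF γ 1 hz).fun_mul hG0)

/-! ### The identity principle: one non-zero wedge gives a dense set of them -/

/-- **Generic non-vanishing.**  For `ℂ`-analytic fields `F, G` on the ball and any `γ ∈ U(2,1)`: if
`(γ^*F)(z) ∧ G(z) ≠ 0` at ONE point, the set of such points is DENSE in the ball (the wedge is analytic on
the connected ball; if it vanished on a non-empty open set it would vanish identically). -/
theorem dense_wedge_ne_of_analyticOnNhd {F G : (Fin 2 → ℂ) → (Fin 2 → ℂ)}
    (hF : AnalyticOnNhd ℂ F ballSet) (hG : AnalyticOnNhd ℂ G ballSet) (γ : U21)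
    (h : ∃ z : Ball, wedge ((Jac γ z)ᵀ *ᵥ F (act γ z).1) (G z.1) ≠ 0) :
    Dense {z : Ball | wedge ((Jac γ z)ᵀ *ᵥ F (act γ z).1) (G z.1) ≠ 0} := by
  have hw : AnalyticOnNhd ℂ (wedgeE γ F G) ballSet := analyticOnNhd_wedgeE hF hG γ
  rw [dense_iff_inter_open]
  intro V hV hVne
  by_contra hempty
  rw [Set.not_nonempty_iff_eq_empty] at hempty
  have hzero : ∀ z ∈ V, wedgeE γ F G z.1 = 0 := by
    intro z hz
    by_contra hne
    have hmem : z ∈ V ∩ {z : Ball | wedge ((Jac γ z)ᵀ *ᵥ F (act γ z).1) (G z.1) ≠ 0} :=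
      ⟨hz, by rw [Set.mem_setOf_eq, wedge_eq_wedgeE]; exact hne⟩
    rw [hempty] at hmem
    exact hmem
  obtain ⟨z₁, hz₁⟩ := hVne
  have hind : Topology.IsInducing (Subtype.val : Ball → (Fin 2 → ℂ)) := Topology.IsInducing.subtypeVal
  obtain ⟨V', hV'o, hV'eq⟩ := hind.isOpen_iff.mp hV
  have hev : wedgeE γ F G =ᶠ[nhds z₁.1] 0 := by
    have hopen : IsOpen (V' ∩ ballSet) := hV'o.inter isOpen_ballSet
    have hmem : z₁.1 ∈ V' ∩ ballSet := ⟨by rw [← hV'eq] at hz₁; exact hz₁, z₁.2⟩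
    refine Filter.eventually_of_mem (hopen.mem_nhds hmem) ?_
    intro z hz
    have hzV : (⟨z, hz.2⟩ : Ball) ∈ V := by rw [← hV'eq]; exact hz.1
    show wedgeE γ F G z = 0
    exact hzero ⟨z, hz.2⟩ hzV
  have hall : Set.EqOn (wedgeE γ F G) 0 ballSet :=
    hw.eqOn_zero_of_preconnected_of_eventuallyEq_zero isPreconnected_ballSet z₁.2 hev
  obtain ⟨z, hz⟩ := h
  apply hz
  rw [wedge_eq_wedgeE]
  exact hall z.2

/-- The restriction of an analytic field to the ball is continuous. -/
theorem continuous_restrict {F : (Fin 2 → ℂ) → (Fin 2 → ℂ)} (hF : AnalyticOnNhd ℂ F ballSet) :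
    Continuous fun z : Ball => F z.1 :=
  hF.continuousOn.comp_continuous continuous_ball_val val_mem_ballSet

/-- For continuous `F, G` and fixed `γ`, the set of points with a non-zero wedge is open. -/
theorem isOpen_wedge_ne_right {F G : Ball → Fin 2 → ℂ} (hF : Continuous F) (hG : Continuous G)
    (γ : U21) : IsOpen {z : Ball | wedge ((Jac γ z)ᵀ *ᵥ F (act γ z)) (G z) ≠ 0} := by
  refine isOpen_ne_fun ?_ continuous_const
  exact Continuous.comp (f := fun z : Ball => (γ, z))
    (g := fun p : U21 × Ball => wedge ((Jac p.1 p.2)ᵀ *ᵥ F (act p.1 p.2)) (G p.2))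
    (continuous_wedge_pullback hF hG) (continuous_const.prodMk continuous_id)

/-- **Generic form of statement (c).**  For a dense subgroup `Δ ≤ U(2,1)` and `ℂ`-analytic fields `F, G`
on the ball that are not identically zero there, some `γ ∈ Δ` has `{z | (γ^*F)(z) ∧ G(z) ≠ 0}` OPEN and
DENSE in `𝔹²` (statement (c) gives one point; analyticity spreads it). -/
theorem exists_mem_isOpen_dense_wedge_ne {Δ : Subgroup U21} (hΔ : Dense (Δ : Set U21))
    {F G : (Fin 2 → ℂ) → (Fin 2 → ℂ)} (hF : AnalyticOnNhd ℂ F ballSet) (hG : AnalyticOnNhd ℂ G ballSet)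
    (hF0 : ∃ w : Ball, F w.1 ≠ 0) (hG0 : ∃ z : Ball, G z.1 ≠ 0) :
    ∃ γ ∈ Δ, IsOpen {z : Ball | wedge ((Jac γ z)ᵀ *ᵥ F (act γ z).1) (G z.1) ≠ 0} ∧
      Dense {z : Ball | wedge ((Jac γ z)ᵀ *ᵥ F (act γ z).1) (G z.1) ≠ 0} := by
  have hFc : Continuous fun z : Ball => F z.1 := continuous_restrict hF
  have hGc : Continuous fun z : Ball => G z.1 := continuous_restrict hG
  obtain ⟨γ₀, z, h₀⟩ := BallCore.exists_wedge_ne_zero (fun z : Ball => F z.1) (fun z : Ball => G z.1) hF0 hG0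
  obtain ⟨γ, hγΔ, hγ⟩ := exists_mem_wedge_ne_of_dense hΔ hFc hGc h₀
  exact ⟨γ, hγΔ, isOpen_wedge_ne_right hFc hGc γ, dense_wedge_ne_of_analyticOnNhd hF hG γ ⟨z, hγ⟩⟩

end BallHolo

end Summit.Ventures.HodgeRepro

end
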